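import Summits.CriticalPhenomena.PercolationContinuityZ3.Theorems.PercNonProliferationSubpolynomialBlockingStubProductFloor
import Summits.CriticalPhenomena.PercolationContinuityZ3.Theorems.PercNonProliferationSubpolynomialBlockingStubInArmLeHalfSpaceReach
import Summits.CriticalPhenomena.PercolationContinuityZ3.Theorems.PercNonProliferationSubpolynomialBlockingStubOutArmLeSiteToBoundary
import Summits.CriticalPhenomena.PercolationContinuityZ3.Theorems.PercNonProliferationSubpolynomialBlockingStubFloorOfArmRates
import Summits.CriticalPhenomena.PercolationContinuityZ3.Theorems.PercNonProliferationSubpolynomialBlockingSubsurface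
import Summits.CriticalPhenomena.PercolationContinuityZ3.Theorems.PercNonProliferationSubpolynomialBlockingCritCrossingPos
import Literature.Probability.Percolation.BKFinitary
import Literature.Probability.Percolation.SharpnessDCTProofs
import HarnessLib

/-!
# Line `SketchIdeator5` (two-sided charging) for the crux `SubpolynomialBlocking` (stmt-CriticalPhenomena-4446) — lead's skeleton

Lead a1 (prover-line-stmt-CriticalPhenomena-4446-a1-0, 2026-08-16), owned from the ideator's
`Cruxes/SubpolynomialBlocking/SketchIdeator5.lean` (crux-ideate round 2, ideator 5; card
`Ideas/two-sided-charging-floor.md`, memo `MEMO-ideator5-r2.md` §2). The card labels this a FLOOR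
MECHANISM + TYPED CEILING, not a closing line; the skeleton makes that precise: the composition
`SubpolynomialBlocking_of` closes the crux from the provable floor stubs 1–2 AND the residual stub 5
(`stub_chargeSubLog`: the two-sided charge is `o(log n)`), which the card itself expects to be FALSE
(charge `≍ n^{2 - x_s - x_b} ≈ n^{0.545}`); stub 5 is registered so that the line's death is a
kernel-checked statement about ONE named quantity, attacked numerically (kit job) and by the disprover.

THE OBJECTS (critical bond percolation on `ℤ³`, `μ = bondPercolation (zdGraph 3) p`, mid-radius
`m = n + ⌊n/2⌋`, mid-sphere `∂ⁱⁿΛ_m`):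
* `inArm v n  = {∃ x ∈ Λ_n, v ↔ x inside Λ_m}` (inward, half-space-type arm of depth `⌊n/2⌋`),
* `outArm v n = {∃ y ∈ ∂ⁱⁿΛ_{2n}, v ↔ y inside Λ_{2n}}` (outward bulk arm of reach `≥ n - ⌊n/2⌋`),
* `blockEv n` = the crux's event verbatim (`= (annulusCrossing 3 n)ᶜ`, probability `Negative.blockProb 3 p n`),
* `charge p n = Σ_{v ∈ ∂ⁱⁿΛ_m} μ(inArm v n) · μ(outArm v n)`.

THE STUBS (registered; tree vocabulary only):
1. `stub_productFloor` (M, LANDED p128649 — the lead's): `∏_{v ∈ ∂ⁱⁿΛ_m} (1 - μ(inArm v n) μ(outArm v n)) ≤ u_n(p)`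
   for every `p`, `n ≥ 1` (first exit at the mid-sphere ⇒ `Cross_n ⊆ ⋃_v inArm v □ outArm v`; BK; Harris).
2. `stub_inArm_le_halfSpaceReach` (S, LANDED p128568): `μ(inArm v n) ≤ μ(halfSpaceReach 3 ⌊n/2⌋)` for `v ∈ ∂ⁱⁿΛ_m`
   (Cerf–Dembin symmetry, `Subsurface.measure_active_le_halfSpaceReach`).
3. `stub_outArm_le_siteToBoundary` (S, LANDED p128630): `μ(outArm v n) ≤ μ(siteToBoundary 3 (n - ⌊n/2⌋))` for
   `v ∈ ∂ⁱⁿΛ_m`, `n ≥ 1` (first exit from `v + Λ_{n-⌊n/2⌋}`, `DCT16.armEvent_of_pathIn`, translation invariance).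
4. `stub_floorOfArmRates` (S/M, LANDED p128825, arithmetic over 1–3): a half-space reach rate `n^{-a}` and a
   one-arm rate `n^{-b}` at `p_c(ℤ³)` give `exp(-C n^{2-a-b}) ≤ u_n` eventually — the TYPED CEILING of the class.
5. `stub_chargeSubLog` (RESIDUAL, OPEN, numerically FALSE): `∀ s > 0, ∀ᶠ n, charge p_c n ≤ s · log n`.

COMPOSITION: `SubpolynomialBlocking_of stub_productFloor stub_inArm_le_halfSpaceReach stub_chargeSubLog`
(BGN makes every `μ(inArm)` ≤ 1/2 eventually; `1 - x ≥ e^{-2x}` on `[0,1/2]`; `u_n ≥ e^{-2·charge} ≥ n^{-s}`).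
BY-PRODUCTS (glue, proved here modulo stub 1): `charge_ge` — `∃ c > 0, ∀ n ≥ 1, c ≤ charge p_c n`
(Weierstrass product inequality + `blockProb_le_one_sub`), the rigorous shadow of `x_s + x_b ≤ 2`.

DISPROOF USED (`Cruxes/SubpolynomialBlocking/Disproof.lean`, cdisprove cycle 1 FINAL): §2/§4 — stubs 1–4 hold
at every `p` (and the proof of 1 is `d`-free), so all critical content sits in stub 5, false above `p_c`
exactly like the crux (there `u_n ≤ e^{-γn}` forces charge `≥ γ n / 2`); §6 strengthenings avoided (`∀ s, ∀ᶠ n`);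
§7 floor respected (`n = 1`: every factor is `≥ 1 - p`); §8 Targets: none for this line yet.
-/

noncomputable section

namespace Summit.CriticalPhenomena.PercolationContinuityZ3.Cruxes.SubpolynomialBlocking.TwoSidedCharging

open MeasureTheory Filter Topology
open Literature.Probability.Percolation Literature.Probability.LatticeModels
open Literature.Probability.Percolation.DCT16
open Literature.Probability.Percolation.CerfDembinVanishing
open Literature.Barriers.CriticalPhenomena
open Summit.CriticalPhenomena.PercolationContinuityZ3.Theorems.SubpolynomialBlocking
open Summit.CriticalPhenomena.PercolationContinuityZ3.Theorems.SubpolynomialBlocking.Negative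

/-! ## Objects of the line (local `abbrev`s; the registered stubs below are their unfoldings) -/

/-- Bond percolation on `ℤ³` at parameter `p`. -/
abbrev μ (p : unitInterval) : Measure (BondConfig (Site 3)) := bondPercolation (zdGraph 3) p

/-- The critical parameter of `ℤ³`. -/
abbrev pc : unitInterval := criticalProbI 3

/-- Mid-sphere radius `m = n + ⌊n/2⌋`. -/
abbrev midR (n : ℕ) : ℕ := n + n / 2

/-- The mid-sphere `∂ⁱⁿΛ_m`. -/
abbrev midSphere (n : ℕ) : Finset (Site 3) := innerBoundary (zdGraph 3) (box 3 (n + n / 2))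

/-- Inward arm: `v` is joined to the inner box `Λ_n` by an open path inside `Λ_m`. -/
abbrev inArm (v : Site 3) (n : ℕ) : Set (BondConfig (Site 3)) :=
  {ω | ∃ x ∈ box 3 n, ω ∈ openConnIn (↑(box 3 (n + n / 2)) : Set (Site 3)) v x}

/-- Outward arm: `v` is joined to `∂ⁱⁿΛ_{2n}` by an open path inside `Λ_{2n}`. -/
abbrev outArm (v : Site 3) (n : ℕ) : Set (BondConfig (Site 3)) :=
  {ω | ∃ y ∈ innerBoundary (zdGraph 3) (box 3 (2 * n)),
    ω ∈ openConnIn (↑(box 3 (2 * n)) : Set (Site 3)) v y}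

/-- The crux's blocking event `{Λ_n ↮ ∂ⁱⁿΛ_{2n} inside Λ_{2n}}` (verbatim). -/
abbrev blockEv (n : ℕ) : Set (BondConfig (Site 3)) :=
  {ω | ¬ ∃ x ∈ box 3 n, ∃ y ∈ innerBoundary (zdGraph 3) (box 3 (2 * n)),
    ω ∈ openConnIn (↑(box 3 (2 * n)) : Set (Site 3)) x y}

/-- The two-sided charge `Σ_{v ∈ ∂ⁱⁿΛ_m} μ(inArm v n) μ(outArm v n)`. -/
abbrev charge (p : unitInterval) (n : ℕ) : ℝ :=
  ∑ v ∈ midSphere n, (μ p).real (inArm v n) * (μ p).real (outArm v n)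

/-- Readback: the blocking event is the complement of the barrier file's `annulusCrossing 3 n`. -/
theorem blockEv_eq (n : ℕ) : blockEv n = (annulusCrossing 3 n)ᶜ := rfl

/-- Readback: its probability is `Negative.blockProb 3 p n`. -/
theorem real_blockEv (p : unitInterval) (n : ℕ) : (μ p).real (blockEv n) = blockProb 3 p n := rfl

/-- Encoding check: the crux is `∀ s > 0, ∀ᶠ n, n^{-s} ≤ μ_{p_c}(blockEv n)`. -/
theorem crux_iff_blockEv :
    Summit.CriticalPhenomena.PercolationContinuityZ3.Theses.PercNonProliferation.SubpolynomialBlocking ↔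
      ∀ s : ℝ, 0 < s → ∀ᶠ n : ℕ in atTop, (n : ℝ) ^ (-s) ≤ (μ pc).real (blockEv n) :=
  Iff.rfl

/-! ## The stub statements (local `Prop`s) -/

/-- STUB 1 statement: the two-sided charging floor (every `p`, `n ≥ 1`). -/
abbrev ProductFloor : Prop :=
  ∀ (p : unitInterval) (n : ℕ), 1 ≤ n →
    ∏ v ∈ midSphere n, (1 - (μ p).real (inArm v n) * (μ p).real (outArm v n)) ≤ (μ p).real (blockEv n)

/-- STUB 2 statement: the inward arm of a mid-sphere site is a half-space reach of depth `⌊n/2⌋`. -/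
abbrev InArmLe : Prop :=
  ∀ (p : unitInterval) (n : ℕ) (v : Site 3), v ∈ midSphere n →
    (μ p).real (inArm v n) ≤ (μ p).real (halfSpaceReach 3 (n / 2))

/-- STUB 3 statement: the outward arm of a mid-sphere site is a one-arm event of radius `n - ⌊n/2⌋`. -/
abbrev OutArmLe : Prop :=
  ∀ (p : unitInterval) (n : ℕ) (v : Site 3), 1 ≤ n → v ∈ midSphere n →
    (μ p).real (outArm v n) ≤ (μ p).real (siteToBoundary 3 (n - n / 2))

/-- Half-space reach RATE `a` at `p_c(ℤ³)` (quantitative Barsky–Grimmett–Newman; OPEN for every `a > 0`). -/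
abbrev HalfSpaceReachRate (a : ℝ) : Prop :=
  ∃ C : ℝ, ∀ n : ℕ, 1 ≤ n → (μ pc).real (halfSpaceReach 3 n) ≤ C * (n : ℝ) ^ (-a)

/-- One-arm RATE `b` at `p_c(ℤ³)` (quantified `θ(p_c) = 0`; OPEN and summit-strength for every `b > 0`). -/
abbrev OneArmRate (b : ℝ) : Prop :=
  ∃ C : ℝ, ∀ n : ℕ, 1 ≤ n → (μ pc).real (siteToBoundary 3 n) ≤ C * (n : ℝ) ^ (-b)

/-- STUB 4 statement: the typed ceiling — two arm rates give the floor `exp(-C n^{2-a-b}) ≤ u_n`. -/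
abbrev FloorOfArmRates : Prop :=
  ∀ a b : ℝ, HalfSpaceReachRate a → OneArmRate b →
    ∃ C : ℝ, 0 < C ∧ ∀ᶠ n : ℕ in atTop, Real.exp (-(C * (n : ℝ) ^ (2 - a - b))) ≤ (μ pc).real (blockEv n)

/-- STUB 5 statement (RESIDUAL): the critical two-sided charge is `o(log n)`. -/
abbrev ChargeSubLog : Prop :=
  ∀ s : ℝ, 0 < s → ∀ᶠ n : ℕ in atTop, charge pc n ≤ s * Real.log n

/-! ## Registered stubs — EXPANDED, tree vocabulary only (helper files prove these signatures verbatim) -/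

/-- **STUB 1 `productFloor`** (M, PROVABLE NOW, the lead's). For `ω ⊆ E(ℤ³)` crossing the annulus
(`x ∈ Λ_n ↔ y ∈ ∂ⁱⁿΛ_{2n}` inside `Λ_{2n}`), take an open lattice PATH (`exists_walk_of_mem_openConnIn`,
`Walk.bypass`) and its first exit edge `a ∼ b` from `Λ_m` (`y ∉ Λ_m` as `m < 2n`): `a ∈ ∂ⁱⁿΛ_m`, the
initial segment is an open walk inside `Λ_m` from `x` to `a` (witness of `inArm a n`), the rest an open
walk inside `Λ_{2n}` from `a` to `y` (witness of `outArm a n`), and the two edge lists are disjoint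
because a path has no repeated edges ⇒ `ω ∈ inArm a n □ outArm a n`
(`IsUpperSet.mem_disjointOccurrence_iff`). Hence `⋂_v (inArm v □ outArm v)ᶜ ⊆ blockEv n` a.s.
(`real_mono_of_forall_subset_edgeSet`); Harris for the decreasing complements
(`prob_biInter_ge_prod_of_isLowerSet`) and BK (`bk_finitary`, finitary: `isFinitary_openConnIn`) give the
product. [card First lemma; MEMO-ideator5-r2 §2 (R!)] -/
theorem stub_productFloor :
    ∀ (p : unitInterval) (n : ℕ), 1 ≤ n →
      ∏ v ∈ innerBoundary (zdGraph 3) (box 3 (n + n / 2)),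
          (1 - (bondPercolation (zdGraph 3) p).real
                {ω | ∃ x ∈ box 3 n, ω ∈ openConnIn (↑(box 3 (n + n / 2)) : Set (Site 3)) v x} *
              (bondPercolation (zdGraph 3) p).real
                {ω | ∃ y ∈ innerBoundary (zdGraph 3) (box 3 (2 * n)),
                  ω ∈ openConnIn (↑(box 3 (2 * n)) : Set (Site 3)) v y}) ≤
        (bondPercolation (zdGraph 3) p).real
          {ω | ¬ ∃ x ∈ box 3 n, ∃ y ∈ innerBoundary (zdGraph 3) (box 3 (2 * n)),
            ω ∈ openConnIn (↑(box 3 (2 * n)) : Set (Site 3)) x y} :=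
  _root_.Summit.CriticalPhenomena.PercolationContinuityZ3.Theorems.SubpolynomialBlocking.stub_productFloor

/-- **STUB 2 `inArm_le_halfSpaceReach`** (S, PROVABLE NOW). For `v ∈ ∂ⁱⁿΛ_m`, `m = n + ⌊n/2⌋`, on lattice
configurations `inArm v n ⊆ {∃ x ∈ Λ_{m - ⌊n/2⌋}, v ↔ x via withinGraph Λ_m}` (`openConnIn_eq_openConnVia`,
`openClusterIn_withinGraph_eq_top`, symmetry of `openClusterIn`, as in `Subsurface.forall_D_subset_block`), and
`Subsurface.measure_active_le_halfSpaceReach p hv (t := n/2)` bounds the latter by `μ(halfSpaceReach 3 ⌊n/2⌋)`;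
`real_mono_of_forall_subset_edgeSet` + `measureReal` bookkeeping. [Cerf–Dembin 2020 §2; tree p111169] -/
theorem stub_inArm_le_halfSpaceReach :
    ∀ (p : unitInterval) (n : ℕ) (v : Site 3), v ∈ innerBoundary (zdGraph 3) (box 3 (n + n / 2)) →
      (bondPercolation (zdGraph 3) p).real
          {ω | ∃ x ∈ box 3 n, ω ∈ openConnIn (↑(box 3 (n + n / 2)) : Set (Site 3)) v x} ≤
        (bondPercolation (zdGraph 3) p).real (halfSpaceReach 3 (n / 2)) :=
  _root_.Summit.CriticalPhenomena.PercolationContinuityZ3.Theorems.SubpolynomialBlocking.stub_inArm_le_halfSpaceReach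

/-- **STUB 3 `outArm_le_siteToBoundary`** (S, PROVABLE NOW). For `v ∈ ∂ⁱⁿΛ_m` and `y ∈ ∂ⁱⁿΛ_{2n}` some
coordinate has `|y_j| = 2n ≥ |v_j| + (n - ⌊n/2⌋)`, so `y - v ∉ Λ_k` or `y - v ∈ ∂ⁱⁿΛ_k`, `k = n - ⌊n/2⌋`
(`exists_eq_of_mem_innerBoundary_box`, `mem_box`, `mem_innerBoundary_box_of_natAbs_eq`); an open path inside
`Λ_{2n}` from `v` to `y` (`mem_openConnIn_iff_pathIn`) therefore gives `ω ∈ DCT16.armEvent v k`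
(`DCT16.armEvent_of_pathIn`), and `DCT16.real_armEvent p v k = μ(siteToBoundary 3 k)`;
`real_mono_of_forall_subset_edgeSet`. [DCT 2016 §2.1; tree SharpnessDCTProofs] -/
theorem stub_outArm_le_siteToBoundary :
    ∀ (p : unitInterval) (n : ℕ) (v : Site 3), 1 ≤ n → v ∈ innerBoundary (zdGraph 3) (box 3 (n + n / 2)) →
      (bondPercolation (zdGraph 3) p).real
          {ω | ∃ y ∈ innerBoundary (zdGraph 3) (box 3 (2 * n)),
            ω ∈ openConnIn (↑(box 3 (2 * n)) : Set (Site 3)) v y} ≤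
        (bondPercolation (zdGraph 3) p).real (siteToBoundary 3 (n - n / 2)) :=
  _root_.Summit.CriticalPhenomena.PercolationContinuityZ3.Theorems.SubpolynomialBlocking.stub_outArm_le_siteToBoundary

/-- **STUB 4 `floorOfArmRates`** (S/M, PROVABLE NOW given stubs 1–3 as hypotheses — registered in this
self-contained form so that it can be proved in parallel). From the product floor and the two transfers:
`u_n ≥ ∏_v (1 - h g)` with `h = μ(halfSpaceReach 3 ⌊n/2⌋) ≤ C₁ ⌊n/2⌋^{-a}`, `g = μ(siteToBoundary 3 (n-⌊n/2⌋)) ≤ C₂ (n/2)^{-b}`;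
`h → 0` UNCONDITIONALLY (`tendsto_measure_halfSpaceReach pc` with `BarskyGrimmettNewman1991_Z3_holds`, cf.
`Subsurface.eventually_exp_le_blockProb`), so eventually `h g ≤ 1/2` and `1 - hg ≥ exp(-2hg)`; with
`|∂ⁱⁿΛ_m| ≤ 6 (2m+1)² ≤ 96 n²` (`card_innerBoundary_box_le`) the product is `≥ exp(-2·96 n²·C₁C₂ c_{a,b} n^{-a-b})`.
(If `C₁ ≤ 0` or `C₂ ≤ 0` the floor is trivial.) [card `floor_of_armRates`; MEMO-ideator5-r2 §2 typed ceiling] -/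
theorem stub_floorOfArmRates :
    (∀ (p : unitInterval) (n : ℕ), 1 ≤ n →
      ∏ v ∈ innerBoundary (zdGraph 3) (box 3 (n + n / 2)),
          (1 - (bondPercolation (zdGraph 3) p).real
                {ω | ∃ x ∈ box 3 n, ω ∈ openConnIn (↑(box 3 (n + n / 2)) : Set (Site 3)) v x} *
              (bondPercolation (zdGraph 3) p).real
                {ω | ∃ y ∈ innerBoundary (zdGraph 3) (box 3 (2 * n)),
                  ω ∈ openConnIn (↑(box 3 (2 * n)) : Set (Site 3)) v y}) ≤
        (bondPercolation (zdGraph 3) p).real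
          {ω | ¬ ∃ x ∈ box 3 n, ∃ y ∈ innerBoundary (zdGraph 3) (box 3 (2 * n)),
            ω ∈ openConnIn (↑(box 3 (2 * n)) : Set (Site 3)) x y}) →
    (∀ (p : unitInterval) (n : ℕ) (v : Site 3), v ∈ innerBoundary (zdGraph 3) (box 3 (n + n / 2)) →
      (bondPercolation (zdGraph 3) p).real
          {ω | ∃ x ∈ box 3 n, ω ∈ openConnIn (↑(box 3 (n + n / 2)) : Set (Site 3)) v x} ≤
        (bondPercolation (zdGraph 3) p).real (halfSpaceReach 3 (n / 2))) →
    (∀ (p : unitInterval) (n : ℕ) (v : Site 3), 1 ≤ n → v ∈ innerBoundary (zdGraph 3) (box 3 (n + n / 2)) →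
      (bondPercolation (zdGraph 3) p).real
          {ω | ∃ y ∈ innerBoundary (zdGraph 3) (box 3 (2 * n)),
            ω ∈ openConnIn (↑(box 3 (2 * n)) : Set (Site 3)) v y} ≤
        (bondPercolation (zdGraph 3) p).real (siteToBoundary 3 (n - n / 2))) →
    ∀ a b : ℝ,
      (∃ C : ℝ, ∀ n : ℕ, 1 ≤ n →
        (bondPercolation (zdGraph 3) (criticalProbI 3)).real (halfSpaceReach 3 n) ≤ C * (n : ℝ) ^ (-a)) →
      (∃ C : ℝ, ∀ n : ℕ, 1 ≤ n →
        (bondPercolation (zdGraph 3) (criticalProbI 3)).real (siteToBoundary 3 n) ≤ C * (n : ℝ) ^ (-b)) →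
      ∃ C : ℝ, 0 < C ∧ ∀ᶠ n : ℕ in atTop, Real.exp (-(C * (n : ℝ) ^ (2 - a - b))) ≤
        (bondPercolation (zdGraph 3) (criticalProbI 3)).real
          {ω | ¬ ∃ x ∈ box 3 n, ∃ y ∈ innerBoundary (zdGraph 3) (box 3 (2 * n)),
            ω ∈ openConnIn (↑(box 3 (2 * n)) : Set (Site 3)) x y} :=
  _root_.Summit.CriticalPhenomena.PercolationContinuityZ3.Theorems.SubpolynomialBlocking.stub_floorOfArmRates

/-- **STUB 5 `chargeSubLog`** (RESIDUAL — OPEN, and EXPECTED FALSE: the card's own falsifier puts the charge at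
`≍ n^{2 - x_s - x_b} ≈ n^{0.545}`, MEMO-ideator5-r2 §2; rigorously only `c ≤ charge ≤ 96 n² · h'_{⌊n/2⌋} = o(n²)` is
known, `charge_ge` below and BGN). It is exactly what the composition needs beyond the floor: the critical
two-sided charge `Σ_{v ∈ ∂ⁱⁿΛ_m} μ_{p_c}(inArm v n) μ_{p_c}(outArm v n)` is `o(log n)`. Registered so that the line's
fate is ONE named, numerically testable quantity (kit MC job of this seat; disprover target). -/
theorem stub_chargeSubLog :
    ∀ s : ℝ, 0 < s → ∀ᶠ n : ℕ in atTop,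
      (∑ v ∈ innerBoundary (zdGraph 3) (box 3 (n + n / 2)),
          (bondPercolation (zdGraph 3) (criticalProbI 3)).real
              {ω | ∃ x ∈ box 3 n, ω ∈ openConnIn (↑(box 3 (n + n / 2)) : Set (Site 3)) v x} *
            (bondPercolation (zdGraph 3) (criticalProbI 3)).real
              {ω | ∃ y ∈ innerBoundary (zdGraph 3) (box 3 (2 * n)),
                ω ∈ openConnIn (↑(box 3 (2 * n)) : Set (Site 3)) v y}) ≤ s * Real.log n := by
  sorry

/-! ### Name-keyed aliases of the stub statements (hypotheses of the composition) -/
namespace Registered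

/-- Alias of `ProductFloor` keyed by the registered stub name. -/
abbrev stub_productFloor : Prop := ProductFloor
/-- Alias of `InArmLe` keyed by the registered stub name. -/
abbrev stub_inArm_le_halfSpaceReach : Prop := InArmLe
/-- Alias of `OutArmLe` keyed by the registered stub name. -/
abbrev stub_outArm_le_siteToBoundary : Prop := OutArmLe
/-- Alias of `FloorOfArmRates` (with its three front-end hypotheses) keyed by the registered stub name. -/
abbrev stub_floorOfArmRates : Prop := ProductFloor → InArmLe → OutArmLe → FloorOfArmRates
/-- Alias of `ChargeSubLog` keyed by the registered stub name. -/
abbrev stub_chargeSubLog : Prop := ChargeSubLog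

end Registered

/-! ### Readbacks: the expanded registered signatures ARE the local `Prop`s (definitional) -/

example : Registered.stub_productFloor := stub_productFloor
example : Registered.stub_inArm_le_halfSpaceReach := stub_inArm_le_halfSpaceReach
example : Registered.stub_outArm_le_siteToBoundary := stub_outArm_le_siteToBoundary
example : Registered.stub_floorOfArmRates := stub_floorOfArmRates
example : Registered.stub_chargeSubLog := stub_chargeSubLog

/-! ## The typed ceiling, unconditionally in the stubs (1–4 landed) -/

/-- **The typed ceiling of the charging class** (stubs 1–4, all LANDED): any half-space reach rate `n^{-a}` and
one-arm rate `n^{-b}` at `p_c(ℤ³)` give `exp(-C n^{2-a-b}) ≤ u_n` eventually. Polynomial iff `a + b ≥ 2`; and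
`a + b ≤ 2` is forced (`armRate_exponents_sum_le_two`, corollaries file), so the class reaches a polynomial floor
only in the knife-edge case `a + b = 2`, and the crux (`exponent 0`) never (numerically `a + b ≈ 1.455`). -/
theorem floorOfArmRates : FloorOfArmRates :=
  stub_floorOfArmRates stub_productFloor stub_inArm_le_halfSpaceReach stub_outArm_le_siteToBoundary

/-! ## Proved plumbing -/

/-- `0 ≤ μ(inArm) ≤ 1`, `0 ≤ μ(outArm) ≤ 1`: each factor `1 - h g` of the product lies in `[0, 1]`. -/
theorem factor_mem_Icc (p : unitInterval) (v : Site 3) (n : ℕ) :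
    1 - (μ p).real (inArm v n) * (μ p).real (outArm v n) ∈ Set.Icc (0 : ℝ) 1 := by
  have h1 : (μ p).real (inArm v n) ≤ 1 := measureReal_le_one
  have h2 : (μ p).real (outArm v n) ≤ 1 := measureReal_le_one
  have h3 : 0 ≤ (μ p).real (inArm v n) := measureReal_nonneg
  have h4 : 0 ≤ (μ p).real (outArm v n) := measureReal_nonneg
  constructor
  · nlinarith
  · nlinarith [mul_nonneg h3 h4]

/-- `0 ≤ charge`. -/
theorem charge_nonneg (p : unitInterval) (n : ℕ) : 0 ≤ charge p n :=
  Finset.sum_nonneg fun _ _ => mul_nonneg measureReal_nonneg measureReal_nonneg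

/-- Weierstrass' product inequality: `1 - Σ xᵢ ≤ ∏ (1 - xᵢ)` for `xᵢ ∈ [0, 1]`. -/
theorem one_sub_sum_le_prod {ι : Type*} (s : Finset ι) (x : ι → ℝ) (h0 : ∀ i ∈ s, 0 ≤ x i)
    (h1 : ∀ i ∈ s, x i ≤ 1) : 1 - ∑ i ∈ s, x i ≤ ∏ i ∈ s, (1 - x i) := by
  classical
  induction s using Finset.induction_on with
  | empty => simp
  | insert j s hj ih =>
    rw [Finset.sum_insert hj, Finset.prod_insert hj]
    have h0' : ∀ i ∈ s, 0 ≤ x i := fun i hi => h0 i (Finset.mem_insert_of_mem hi)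
    have h1' : ∀ i ∈ s, x i ≤ 1 := fun i hi => h1 i (Finset.mem_insert_of_mem hi)
    have hprod0 : 0 ≤ ∏ i ∈ s, (1 - x i) := Finset.prod_nonneg fun i hi => by linarith [h1' i hi]
    have hprod1 : ∏ i ∈ s, (1 - x i) ≤ 1 :=
      Finset.prod_le_one (fun i hi => by linarith [h1' i hi]) fun i hi => by linarith [h0' i hi]
    have hxj0 := h0 j (Finset.mem_insert_self j s)
    have hxj1 := h1 j (Finset.mem_insert_self j s)
    nlinarith [ih h0' h1', mul_nonneg hxj0 (sub_nonneg.2 hprod1)]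

/-- `exp(-2x) ≤ 1 - x` for `x ∈ [0, 1/2]` (via `1 + 2x ≤ e^{2x}` and `(1 - x)(1 + 2x) ≥ 1`). -/
theorem exp_neg_two_mul_le {x : ℝ} (h0 : 0 ≤ x) (h1 : x ≤ 1 / 2) : Real.exp (-(2 * x)) ≤ 1 - x := by
  have hexp : 2 * x + 1 ≤ Real.exp (2 * x) := Real.add_one_le_exp _
  have hpos : 0 < 2 * x + 1 := by linarith
  rw [Real.exp_neg]
  calc (Real.exp (2 * x))⁻¹ ≤ (2 * x + 1)⁻¹ := inv_anti₀ hpos hexp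
    _ ≤ 1 - x := by
        rw [inv_le_iff_one_le_mul₀ hpos]
        nlinarith

/-! ## Composition, part 1: STUB 1 ⟹ the charge is bounded below (`x_s + x_b ≤ 2`, rigorous shadow) -/

/-- **`1 - charge ≤ u_n`** (every `p`, `n ≥ 1`): Weierstrass applied to the product floor. -/
theorem one_sub_charge_le (hpf : ProductFloor) (p : unitInterval) {n : ℕ} (hn : 1 ≤ n) :
    1 - charge p n ≤ (μ p).real (blockEv n) := by
  refine le_trans ?_ (hpf p n hn)
  refine one_sub_sum_le_prod (midSphere n) (fun v => (μ p).real (inArm v n) * (μ p).real (outArm v n))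
    (fun v _ => mul_nonneg measureReal_nonneg measureReal_nonneg) fun v _ => ?_
  exact mul_le_one₀ measureReal_le_one measureReal_nonneg measureReal_le_one

/-- **The critical charge is bounded below**: `∃ c > 0, ∀ n ≥ 1, c ≤ charge p_c n` — from `1 - charge ≤ u_n ≤ 1 - c`
(`blockProb_le_one_sub`, p118164). Heuristically `charge ≍ n^{2 - x_s - x_b}`, so this is the rigorous
`x_s + x_b ≤ 2` of MEMO-ideator5-r2 §2. -/
theorem charge_ge (hpf : ProductFloor) : ∃ c : ℝ, 0 < c ∧ ∀ n : ℕ, 1 ≤ n → c ≤ charge pc n := by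
  obtain ⟨c, hc, h⟩ := blockProb_le_one_sub 3 (by norm_num)
  refine ⟨c, hc, fun n hn => ?_⟩
  have h1 := one_sub_charge_le hpf pc hn
  have h2 := h n hn
  rw [real_blockEv] at h1
  linarith

/-! ## Composition, part 2: STUBS 1 + 2 + 5 ⟹ the crux -/

/-- BGN: the half-space reach probability at depth `⌊n/2⌋` tends to `0` at `p_c(ℤ³)` (tree's proved
`BarskyGrimmettNewman1991_Z3_holds` through `CerfDembinVanishing.tendsto_measure_halfSpaceReach`). -/
theorem tendsto_halfSpaceReach_half :
    Tendsto (fun n : ℕ => (μ pc).real (halfSpaceReach 3 (n / 2))) atTop (𝓝 0) := by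
  have h' : Tendsto (fun t => ((bondPercolation (zdGraph 3) pc) (halfSpaceReach 3 t)).toReal) atTop
      (𝓝 (0 : ENNReal).toReal) :=
    (ENNReal.tendsto_toReal ENNReal.zero_ne_top).comp
      (tendsto_measure_halfSpaceReach pc BarskyGrimmettNewman1991_Z3_holds)
  rw [ENNReal.toReal_zero] at h'
  have h'' : Tendsto (fun t : ℕ => (μ pc).real (halfSpaceReach 3 t)) atTop (𝓝 0) := by
    simpa only [measureReal_def] using h'
  exact h''.comp (tendsto_atTop_atTop.2 fun b => ⟨2 * b, fun a ha => by omega⟩)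

/-- **`u_n ≥ exp(-2·charge)` eventually** (stubs 1, 2 + BGN): once `μ(halfSpaceReach 3 ⌊n/2⌋) ≤ 1/2`, every
`h_v g_v ≤ 1/2` and `1 - h_v g_v ≥ exp(-2 h_v g_v)`. -/
theorem eventually_exp_charge_le (hpf : ProductFloor) (hin : InArmLe) :
    ∀ᶠ n : ℕ in atTop, Real.exp (-(2 * charge pc n)) ≤ (μ pc).real (blockEv n) := by
  have hev : ∀ᶠ n : ℕ in atTop, (μ pc).real (halfSpaceReach 3 (n / 2)) < 1 / 2 :=
    tendsto_halfSpaceReach_half.eventually (gt_mem_nhds (by norm_num))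
  filter_upwards [hev, eventually_ge_atTop 1] with n hn hn1
  refine le_trans ?_ (hpf pc n hn1)
  rw [show -(2 * charge pc n) = ∑ v ∈ midSphere n, -(2 * ((μ pc).real (inArm v n) * (μ pc).real (outArm v n)))
    by rw [Finset.sum_neg_distrib, Finset.mul_sum], Real.exp_sum]
  refine Finset.prod_le_prod (fun v _ => (Real.exp_pos _).le) fun v hv => ?_
  refine exp_neg_two_mul_le (mul_nonneg measureReal_nonneg measureReal_nonneg) ?_
  have h1 : (μ pc).real (inArm v n) ≤ 1 / 2 := ((hin pc n v hv).trans hn.le)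
  calc (μ pc).real (inArm v n) * (μ pc).real (outArm v n) ≤ 1 / 2 * 1 :=
        mul_le_mul h1 measureReal_le_one measureReal_nonneg (by norm_num)
    _ = 1 / 2 := by norm_num

/-- **STUBS 1 + 2 + 5 ⟹ the crux**, concluded as `Negative.SubpolynomialBlockingAt 3 p_c` (= the crux by
`Negative.crux_iff`, `Iff.rfl`): `n^{-s} = exp(-s log n) ≤ exp(-2·charge) ≤ u_n` once `charge ≤ (s/2) log n`. -/
theorem subpolynomialBlockingAt_of (hpf : ProductFloor) (hin : InArmLe) (hch : ChargeSubLog) :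
    SubpolynomialBlockingAt 3 (criticalProbI 3) := by
  intro s hs
  have hch' := hch (s / 2) (by positivity)
  filter_upwards [eventually_exp_charge_le hpf hin, hch', eventually_ge_atTop 1] with n hfloor hcharge hn1
  refine le_trans ?_ hfloor
  have hn0 : (0 : ℝ) < n := by exact_mod_cast hn1
  rw [Real.rpow_def_of_pos hn0, Real.exp_le_exp]
  nlinarith

/-! ## The composition, by name -/

/-- **`SubpolynomialBlocking_of`**: the registered stubs 1 (`stub_productFloor`), 2 (`stub_inArm_le_halfSpaceReach`)
and 5 (`stub_chargeSubLog`, the residual) imply the crux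
`Summit.CriticalPhenomena.PercolationContinuityZ3.Theses.PercNonProliferation.SubpolynomialBlocking` BY NAME.
Stubs 3, 4 are the line's typed ceiling (side results), not used here. -/
theorem SubpolynomialBlocking_of (h1 : Registered.stub_productFloor) (h2 : Registered.stub_inArm_le_halfSpaceReach)
    (h5 : Registered.stub_chargeSubLog) :
    Summit.CriticalPhenomena.PercolationContinuityZ3.Theses.PercNonProliferation.SubpolynomialBlocking :=
  Negative.crux_iff.2 (subpolynomialBlockingAt_of h1 h2 h5)

/-- The crux, modulo the `sorry`s of the registered stubs (kernel-checks the composition). -/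
theorem SubpolynomialBlocking_proof :
    Summit.CriticalPhenomena.PercolationContinuityZ3.Theses.PercNonProliferation.SubpolynomialBlocking :=
  SubpolynomialBlocking_of stub_productFloor stub_inArm_le_halfSpaceReach stub_chargeSubLog

end Summit.CriticalPhenomena.PercolationContinuityZ3.Cruxes.SubpolynomialBlocking.TwoSidedCharging

end
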